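import Summits.QuantumAdvantage.AdviceFreeQNC0.StructuredWin
import HarnessLib

/-!
# Cell qa-qnc0 (rung F-Q2-odd, `p = 3`): E2, the unread-gap bound in normal form (ROUND-15 §9.1)

Planner qa-qnc0-p1 g17, route DWalkThree, support `RingUnreadGap3` (stmt-QuantumAdvantage-22506), complexity-free:
a bell vector whose ringing set `R x` does not depend on the bits of a window `[a, a+L)` and avoids the inner cuts
of the window on the odd class wins the ring game (normal form `#{k ∈ R x : D_k(x) ≠ 1}` odd) on at most
`(2^{n+1} + 2^{n+3-L})/3` odd-class patterns `x ∈ {0,1}^{n+1}`.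

Proof (one window, gauge weight `1`, no transport needed): outside content `y` fixed, the window word is affine
`z ↦ s z + T`; on the odd class the sign `s` is forced (`blockSgn_eq_of_odd`), every ringing stake is `α_k + β_k T`
with `β_k ≠ 0` (`dk3_glue_unblk`), so by odd-one-out (`card_odd_le_two`) some translate `t₀` never wins, and the
fibre bound `6·#fib ≤ 2^L + 4` (`DWalkFibres`) gives `3·#{win in the fibre of y} ≤ 2^L + 4` (`card_win_fibre_le`);
summing over `y` (`card_Yset`): **`unreadGap_normalForm`**.

WHAT THIS IS NOT: the ring-language closer is `QuantumAdvantage/Theorems/DWalkThreeRingUnreadGap3.lean`; no complexity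
statement; separation NOT moved.
-/

noncomputable section

namespace Summit.QuantumAdvantage.AdviceFreeQNC0

namespace DWalk

open Finset Equiv
open Literature.Computability.MetaComplexity Literature.Computability.MetaComplexity.Smolensky

section UnreadGap

variable {n a L : ℕ}

/-- One block: the window word of `glue y (unblk B)` is the block word of `B 0`. -/
theorem Pwin_zero_glue_unblk (haW : a + (0 + 1) * L ≤ n) (y : Fin (n + 1) → Bool) (B : Fin (0 + 1) → Fin L → Bool) :
    Pwin a L 0 (1 : ZMod 3) (glue a L 0 y (unblk L 0 B)) = blockPerm 1 (B 0) := by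
  unfold Pwin
  rw [show Fin.last (0 + 1) = (0 : Fin (0 + 1)).succ from rfl, Fin.partialProd_succ, Fin.castSucc_zero,
    Fin.partialProd_zero, one_mul, Gblk_glue_unblk haW]

/-- The weight-1 window data `(sign, translation)` of `glue y (unblk B)` are those of the block `B 0`. -/
theorem window_data (haW : a + (0 + 1) * L ≤ n) (y : Fin (n + 1) → Bool) (B : Fin (0 + 1) → Fin L → Bool) :
    sgnW (xN (glue a L 0 y (unblk L 0 B))) a ((0 + 1) * L) = blockSgn (B 0) ∧
      trW (fun _ => (1 : ZMod 3)) (xN (glue a L 0 y (unblk L 0 B))) a ((0 + 1) * L) = blockTr 1 (B 0) := by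
  have i1 := isAff_wp (kappa 0) (xN (glue a L 0 y (unblk L 0 B))) a ((0 + 1) * L)
  rw [← Pwin_eq_wp (kappaConst_one a L 0), Pwin_zero_glue_unblk haW,
    trW_kappa_window 1 (kappaConst_one a L 0), one_mul] at i1
  exact (isAff_blockPerm (κ₀ := 1) (B 0)).unique i1 |>.imp Eq.symm Eq.symm

/-- **Stake formula.**  For a non-inner cut `k`, the stake of `glue y (unblk B)` is
`A_k(y) + S(y)·(κ_c·T + s·C_k(y))` with `(s, T)` the block data, `S(y) = ±1` the prefix sign and `κ_c ∈ {1, 2}`. -/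
theorem dk3_glue_unblk (haW : a + (0 + 1) * L ≤ n) {k : ℕ} (hk : k ≤ n) (hkni : k ≤ a ∨ a + (0 + 1) * L ≤ k)
    (y : Fin (n + 1) → Bool) (B : Fin (0 + 1) → Fin L → Bool) :
    Dk3 (glue a L 0 y (unblk L 0 B)) k =
      trW (kappa k) (xN y) 0 a + sgnW (xN y) 0 a *
        ((if k ≤ a then (1 : ZMod 3) else 2) * blockTr 1 (B 0) +
          blockSgn (B 0) * trW (kappa k) (xN y) (a + (0 + 1) * L) (n - (a + (0 + 1) * L))) := by
  set x := glue a L 0 y (unblk L 0 B) with hx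
  rw [dk3_eq_trW x hk, trW_window (kappa k) (xN x) haW]
  have hout : ∀ i, ¬ (a ≤ i ∧ i < a + (0 + 1) * L) → xN x i = xN y i := fun i hi => xN_glue_of_not_mem y _ hi
  have h1 : trW (kappa k) (xN x) 0 a = trW (kappa k) (xN y) 0 a :=
    trW_congr fun t ht => ⟨rfl, by rw [Nat.zero_add]; exact hout t (by omega)⟩
  have h2 : sgnW (xN x) 0 a = sgnW (xN y) 0 a :=
    sgnW_congr fun t ht => by rw [Nat.zero_add]; exact hout t (by omega)
  have h3 : trW (kappa k) (xN x) (a + (0 + 1) * L) (n - (a + (0 + 1) * L)) =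
      trW (kappa k) (xN y) (a + (0 + 1) * L) (n - (a + (0 + 1) * L)) :=
    trW_congr fun t _ => ⟨rfl, hout _ (by omega)⟩
  obtain ⟨hs, ht⟩ := window_data haW y B
  have hκc : ∀ i, a ≤ i → i < a + (0 + 1) * L → kappa k i = if k ≤ a then (1 : ZMod 3) else 2 := by
    intro i hi hi'
    unfold kappa
    rcases hkni with h | h
    · rw [if_neg (by omega), if_pos h]
    · rw [if_pos (by omega), if_neg (by omega)]
  rw [trW_kappa_window _ hκc (xN x), h1, h2, h3, hs, ht]

/-- On the odd class the window sign is forced by the outside content: `s = ỹ(εb y)`. -/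
theorem blockSgn_eq_of_odd (haW : a + (0 + 1) * L ≤ n) (y : Fin (n + 1) → Bool) (B : Fin (0 + 1) → Fin L → Bool)
    (hodd : (univ.filter fun j : Fin (n + 1) => glue a L 0 y (unblk L 0 B) j = false).card % 2 = 1) :
    blockSgn (B 0) = yt (εb a L 0 y) := by
  have hB : B ∈ BlkSet L 0 (1 : ZMod 3) (fun j => blockPerm 1 (B j)) := mem_BlkSet.2 fun _ => rfl
  have h := (odd_glue_unblk_iff (kappaConst_one a L 0) haW y hB).1 hodd
  rw [show Fin.last (0 + 1) = (0 : Fin (0 + 1)).succ from rfl, Fin.partialProd_succ, Fin.castSucc_zero,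
    Fin.partialProd_zero, one_mul, sgnP_of_isAff (isAff_blockPerm (κ₀ := (1 : ZMod 3)) (B 0))] at h
  -- `blockSgn = ±1 = ỹ(c)` for the bit `c := [blockSgn = 1]`
  have hsgn : blockSgn (B 0) = yt (decide (blockSgn (B 0) = 1)) := by
    unfold blockSgn
    rw [sgnW_eq_ite]
    split_ifs <;> decide
  rw [hsgn] at h ⊢
  rw [(admS_yt_iff y _).1 h]

/-- The prefix sign times a weight `1` or `2` is non-zero. -/
theorem sgnW_mul_ne_zero (x : ℕ → Bool) (a l : ℕ) (P : Prop) [Decidable P] :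
    sgnW x a l * (if P then (1 : ZMod 3) else 2) ≠ 0 := by
  rw [sgnW_eq_ite]
  split_ifs <;> decide

/-- **Fibre count.**  Fix the outside content `y`.  If the ringing set is the same `R₀` throughout the fibre of `y`
and avoids the inner cuts on the odd class, then `3·#{B : glue y B odd and winning} ≤ 2^L + 4`. -/
theorem card_win_fibre_le (hL : 1 ≤ L) (haW : a + (0 + 1) * L ≤ n) (y : Fin (n + 1) → Bool)
    (R₀ : Finset (Fin (n + 1)))
    (hR₀ : ∀ B : Fin (0 + 1) → Fin L → Bool,
      (univ.filter fun j : Fin (n + 1) => glue a L 0 y (unblk L 0 B) j = false).card % 2 = 1 →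
        ∀ k ∈ R₀, k.val ≤ a ∨ a + (0 + 1) * L ≤ k.val) :
    3 * ((univ.filter fun B : Fin (0 + 1) → Fin L → Bool =>
        (univ.filter fun j : Fin (n + 1) => glue a L 0 y (unblk L 0 B) j = false).card % 2 = 1 ∧
          (R₀.filter fun k => Dk3 (glue a L 0 y (unblk L 0 B)) k.val ≠ 1).card % 2 = 1).card : ℤ) ≤
      (2 : ℤ) ^ L + 4 := by
  classical
  -- the affine stakes on the odd class
  set σ : ZMod 3 := yt (εb a L 0 y) with hσ
  set α : ℕ → ZMod 3 := fun k => trW (kappa k) (xN y) 0 a +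
    sgnW (xN y) 0 a * (σ * trW (kappa k) (xN y) (a + (0 + 1) * L) (n - (a + (0 + 1) * L))) with hα
  set β : ℕ → ZMod 3 := fun k => sgnW (xN y) 0 a * (if k ≤ a then (1 : ZMod 3) else 2) with hβ
  have hβ0 : ∀ k, β k ≠ 0 := fun k => sgnW_mul_ne_zero _ _ _ _
  set Ks : ZMod 3 → Finset (Fin (n + 1)) := fun t => univ.filter fun k : Fin (n + 1) => α k.val + β k.val * t ≠ 1
    with hKs
  have hK : ∀ k ∈ R₀, (univ.filter fun t : ZMod 3 => k ∈ Ks t).card = 2 := by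
    intro k _
    have hlive : ∀ u v : ZMod 3, v ≠ 0 → (univ.filter fun t : ZMod 3 => u + v * t ≠ 1).card = 2 := by decide
    have : (univ.filter fun t : ZMod 3 => k ∈ Ks t) = univ.filter fun t : ZMod 3 => α k.val + β k.val * t ≠ 1 := by
      ext t; simp [hKs]
    rw [this]; exact hlive _ _ (hβ0 k.val)
  -- odd-one-out: some translate never wins
  obtain ⟨t₀, ht₀⟩ : ∃ t₀ : ZMod 3, ¬ ((R₀.filter fun k => k ∈ Ks t₀).card % 2 = 1) := by
    by_contra hall
    have h3 : (univ.filter fun t : ZMod 3 => (R₀.filter fun k => k ∈ Ks t).card % 2 = 1) = univ := by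
      refine Finset.filter_true_of_mem fun t _ => ?_
      by_contra ht; exact hall ⟨t, ht⟩
    have h2 := card_odd_le_two R₀ Ks hK
    rw [h3, card_univ, ZMod.card] at h2
    omega
  -- odd winning blocks lie in the fibres of the two other translates
  set S : Finset (Fin L → Bool) := (univ.erase t₀).biUnion fun t => fib (1 : ZMod 3) L (affP (εb a L 0 y) t) with hS
  have hsub : ∀ B : Fin (0 + 1) → Fin L → Bool,
      ((univ.filter fun j : Fin (n + 1) => glue a L 0 y (unblk L 0 B) j = false).card % 2 = 1 ∧
        (R₀.filter fun k => Dk3 (glue a L 0 y (unblk L 0 B)) k.val ≠ 1).card % 2 = 1) → B 0 ∈ S := by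
    rintro B ⟨hodd, hwin⟩
    have hs := blockSgn_eq_of_odd haW y B hodd
    -- the winning count is the count of `Ks (blockTr (B 0))`
    have hset : (R₀.filter fun k => Dk3 (glue a L 0 y (unblk L 0 B)) k.val ≠ 1) =
        R₀.filter fun k => k ∈ Ks (blockTr 1 (B 0)) := by
      refine Finset.filter_congr fun k hk => ?_
      have hkni := hR₀ B hodd k hk
      have e : Dk3 (glue a L 0 y (unblk L 0 B)) k.val = α k.val + β k.val * blockTr 1 (B 0) := by
        rw [dk3_glue_unblk haW (show k.val ≤ n by have := k.isLt; omega) hkni y B, hs]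
        simp only [hα, hβ, hσ]
        ring
      rw [e]
      simp only [hKs, mem_filter, mem_univ, true_and]
    rw [hset] at hwin
    have hne : blockTr 1 (B 0) ≠ t₀ := fun h => ht₀ (h ▸ hwin)
    rw [hS, Finset.mem_biUnion]
    refine ⟨blockTr 1 (B 0), Finset.mem_erase.2 ⟨hne, mem_univ _⟩, ?_⟩
    rw [fib_eq_filter (isAff_affP (εb a L 0 y) (blockTr 1 (B 0))), mem_filter]
    exact ⟨mem_univ _, hs, rfl⟩
  -- counting
  have hcard : ((univ.filter fun B : Fin (0 + 1) → Fin L → Bool =>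
      (univ.filter fun j : Fin (n + 1) => glue a L 0 y (unblk L 0 B) j = false).card % 2 = 1 ∧
        (R₀.filter fun k => Dk3 (glue a L 0 y (unblk L 0 B)) k.val ≠ 1).card % 2 = 1).card) ≤ S.card := by
    refine Finset.card_le_card_of_injOn (fun B => B 0) (fun B hB => hsub B (Finset.mem_filter.1 hB).2) ?_
    intro B _ B' _ h
    funext j; rw [Fin.eq_zero j]; exact h
  have hS2 : (S.card : ℤ) * 6 ≤ 2 * ((2 : ℤ) ^ L + 4) := by
    have h1 : S.card ≤ ∑ t ∈ univ.erase t₀, (fib (1 : ZMod 3) L (affP (εb a L 0 y) t)).card :=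
      Finset.card_biUnion_le
    have h2 : ∀ t, ((fib (1 : ZMod 3) L (affP (εb a L 0 y) t)).card : ℤ) * 6 ≤ (2 : ℤ) ^ L + 4 := fun t => by
      have := six_mul_card_fib_le (one_ne_zero) hL (affP (εb a L 0 y) t); linarith
    have h3 : ((∑ t ∈ univ.erase t₀, (fib (1 : ZMod 3) L (affP (εb a L 0 y) t)).card : ℕ) : ℤ) * 6 ≤
        2 * ((2 : ℤ) ^ L + 4) := by
      push_cast
      rw [Finset.sum_mul]
      calc ∑ t ∈ univ.erase t₀, ((fib (1 : ZMod 3) L (affP (εb a L 0 y) t)).card : ℤ) * 6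
          ≤ ∑ _t ∈ univ.erase t₀, ((2 : ℤ) ^ L + 4) := Finset.sum_le_sum fun t _ => h2 t
        _ = 2 * ((2 : ℤ) ^ L + 4) := by rw [sum_const, Finset.card_erase_of_mem (mem_univ _), card_univ, ZMod.card]; ring
    have h1' : (S.card : ℤ) ≤ ((∑ t ∈ univ.erase t₀, (fib (1 : ZMod 3) L (affP (εb a L 0 y) t)).card : ℕ) : ℤ) := by
      exact_mod_cast h1
    nlinarith
  have hc' : (((univ.filter fun B : Fin (0 + 1) → Fin L → Bool =>
      (univ.filter fun j : Fin (n + 1) => glue a L 0 y (unblk L 0 B) j = false).card % 2 = 1 ∧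
        (R₀.filter fun k => Dk3 (glue a L 0 y (unblk L 0 B)) k.val ≠ 1).card % 2 = 1).card : ℕ) : ℤ) ≤ S.card := by
    exact_mod_cast hcard
  linarith

/-- **E2 in normal form (the unread-gap bound).**  If the ringing set `R x` does not depend on the window bits and,
on the odd class, avoids the inner cuts of the window `[a, a+L)`, then
`3·#{x odd : #{k ∈ R x : D_k(x) ≠ 1} odd} ≤ 2^{n+1} + 2^{n+3-L}`. -/
theorem unreadGap_normalForm (hL : 1 ≤ L) (haW : a + (0 + 1) * L ≤ n)
    (R : (Fin (n + 1) → Bool) → Finset (Fin (n + 1)))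
    (hRout : ∀ x : Fin (n + 1) → Bool, (univ.filter fun j : Fin (n + 1) => x j = false).card % 2 = 1 →
      ∀ k ∈ R x, k.val ≤ a ∨ a + (0 + 1) * L ≤ k.val)
    (hRind : ∀ x x' : Fin (n + 1) → Bool, (∀ j : Fin (n + 1), ¬ (a ≤ j.val ∧ j.val < a + (0 + 1) * L) → x j = x' j) →
      R x = R x') :
    3 * (univ.filter fun x : Fin (n + 1) → Bool =>
        (univ.filter fun j : Fin (n + 1) => x j = false).card % 2 = 1 ∧
          ((R x).filter fun k => Dk3 x k.val ≠ 1).card % 2 = 1).card ≤ 2 ^ (n + 1) + 2 ^ (n + 3 - L) := by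
  classical
  -- the count as a sum over the fibres of `out`
  set Pr : (Fin (n + 1) → Bool) → Prop := fun x =>
    (univ.filter fun j : Fin (n + 1) => x j = false).card % 2 = 1 ∧
      ((R x).filter fun k => Dk3 x k.val ≠ 1).card % 2 = 1 with hPr
  have hsum : ((univ.filter fun x => Pr x).card : ℝ) =
      ∑ y ∈ Yset a L 0, ∑ B : Fin (0 + 1) → Fin L → Bool, (if Pr (glue a L 0 y (unblk L 0 B)) then (1 : ℝ) else 0) := by
    rw [natCast_card_filter, sum_eq_sum_glue haW]
    refine Finset.sum_congr rfl fun y _ => ?_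
    exact (Fintype.sum_equiv ⟨unblk L 0, wblk L 0, wblk_unblk, unblk_wblk⟩ _ _ fun B => rfl).symm
  -- each fibre contributes at most `(2^L + 4)/3`
  have hfib : ∀ y ∈ Yset a L 0, 3 * ∑ B : Fin (0 + 1) → Fin L → Bool,
      (if Pr (glue a L 0 y (unblk L 0 B)) then (1 : ℝ) else 0) ≤ (2 : ℝ) ^ L + 4 := by
    intro y _
    have hR : ∀ B : Fin (0 + 1) → Fin L → Bool, R (glue a L 0 y (unblk L 0 B)) = R y := fun B =>
      hRind _ _ fun j hj => glue_apply_of_not_mem y _ hj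
    have h := card_win_fibre_le hL haW y (R y) (fun B hodd k hk => hRout _ hodd k (by rw [hR B]; exact hk))
    have heq : ∑ B : Fin (0 + 1) → Fin L → Bool, (if Pr (glue a L 0 y (unblk L 0 B)) then (1 : ℝ) else 0) =
        ((univ.filter fun B : Fin (0 + 1) → Fin L → Bool =>
          (univ.filter fun j : Fin (n + 1) => glue a L 0 y (unblk L 0 B) j = false).card % 2 = 1 ∧
            ((R y).filter fun k => Dk3 (glue a L 0 y (unblk L 0 B)) k.val ≠ 1).card % 2 = 1).card : ℝ) := by
      rw [natCast_card_filter]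
      refine Finset.sum_congr rfl fun B _ => ?_
      simp only [hPr, hR B]
    rw [heq]
    have h' : ((3 * ((univ.filter fun B : Fin (0 + 1) → Fin L → Bool =>
        (univ.filter fun j : Fin (n + 1) => glue a L 0 y (unblk L 0 B) j = false).card % 2 = 1 ∧
          ((R y).filter fun k => Dk3 (glue a L 0 y (unblk L 0 B)) k.val ≠ 1).card % 2 = 1).card : ℤ) : ℤ) : ℝ) ≤
        (((2 : ℤ) ^ L + 4 : ℤ) : ℝ) := by exact_mod_cast h
    push_cast at h'
    exact h'
  have hY := card_Yset (n := n) (a := a) (L := L) (m := 0) haW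
  have htot : 3 * ((univ.filter fun x => Pr x).card : ℝ) ≤ ((Yset (n := n) a L 0).card : ℝ) * ((2 : ℝ) ^ L + 4) := by
    rw [hsum, Finset.mul_sum]
    calc ∑ y ∈ Yset a L 0, 3 * ∑ B : Fin (0 + 1) → Fin L → Bool, (if Pr (glue a L 0 y (unblk L 0 B)) then (1 : ℝ) else 0)
        ≤ ∑ _y ∈ Yset a L 0, ((2 : ℝ) ^ L + 4) := Finset.sum_le_sum hfib
      _ = _ := by rw [sum_const, nsmul_eq_mul]
  -- arithmetic: `#Yset · 2^L = 2^{n+1}`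
  have hpow : (2 : ℝ) ^ ((0 + 1) * L) = (2 : ℝ) ^ L := by rw [Nat.zero_add, Nat.one_mul]
  rw [hpow] at hY
  have hL3 : L ≤ n + 3 := by omega
  have hkey : ((Yset (n := n) a L 0).card : ℝ) * ((2 : ℝ) ^ L + 4) = (2 : ℝ) ^ (n + 1) + (2 : ℝ) ^ (n + 3 - L) := by
    have e : (2 : ℝ) ^ (n + 3 - L) * (2 : ℝ) ^ L = (2 : ℝ) ^ (n + 1) * 4 := by
      rw [← pow_add, Nat.sub_add_cancel hL3]; ring
    have h2L : (0 : ℝ) < (2 : ℝ) ^ L := by positivity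
    have hYv : ((Yset (n := n) a L 0).card : ℝ) = (2 : ℝ) ^ (n + 1) / (2 : ℝ) ^ L := by
      rw [eq_div_iff h2L.ne']; exact hY
    rw [hYv]
    field_simp
    linarith
  rw [hkey] at htot
  exact_mod_cast htot

end UnreadGap

end DWalk

end Summit.QuantumAdvantage.AdviceFreeQNC0

end
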